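import Summits.QuantumFields.BalabanUV.Beta.FP.PeriodisedWardOrderOneTowerClosing
import Summits.QuantumFields.BalabanUV.Beta.FP.TorusCompositeCompanionFamilyG
import Summits.QuantumFields.BalabanUV.Beta.PeriodisedIndexLawSummable
import Summits.QuantumFields.BalabanUV.Beta.FP.PeriodisedFormIndexWardDoubled

/-!
# `BalabanUV.Beta.FP.TowerCompanionInstance` — road «FP» for binder row D1, ROUTE T (β1), the OWNER d1-p3's R-FP-75 (J-RISK-3′, «leaf-05: the `G` instance»):
# **THE COMPANION FAMILY OF THE TOWER's `a1` CLOSING EXISTS, IS ANTISYMMETRIC, AND THE DOOR's `hH₁t` ∕ `a1` HOLD AT THE TOTAL SLOT WITH `hG` DISCHARGED**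

WHY.  `PeriodisedWardOrderOneTowerClosing.tower_a1_row_towerGen_eq_zero` (leaf-05 g44, p393863 ✓) closes the depth-`n` tower's first-order Ward row for an
ABSTRACT torus-indexed companion family `G : ∀ T, Matrix (↥(pbox T) × Fin (d+1)) (same) ℝ` (leaf-06's indexing, `TorusCompositeCompanionSumG.compSumSym Lc G …`)
under the identifications `hG k` (`k < n`): `G (towerTorus Lc M k) = w k • Σ_ā hb k ā • (perF (towerTorus Lc M k) (dper … (SLam N (cf k) (symHessFFAt ρ_c Lc) ā.2 ā.1)))|ff`
— the storeys' periodised Λ-sector families along the storey directions.  The storey data (`w k`, `hb k`, `cf k`) is indexed by the STOREY `k`, the companions by the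
TORUS they live on; R-FP-75 asks leaf-05 for the instance: a torus-indexed `G` realising the `n` storey prescriptions.  The storey tori `towerTorus Lc M k`
(`= Lc^k · M`, `towerTorus_apply`) are pairwise distinct as soon as `2 ≤ Lc`, so ANY storey-indexed prescription is the restriction of a torus-indexed family — leaf-06 g38's
NAMED extension by zero `TorusCompositeCompanionFamilyG.onTowerFamily` (the OWNER's W-FP-33-4: «the pass wants the companion family WRITTEN in statements»; injectivity
`towerTorus_injective` there); this file supplies the def-free corollaries, uniqueness, linearity and parity transfer (§2), the Λ member's parity in the closing's
currency (§3), the door's `hH₁t` at the TOTAL slot (§4), and the closing at the named family (§5).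

WHAT ([folklore] + [our object — bookkeeping] BY NAME over OUR typed objects; no `def`, no `def … : Prop`, nothing cited, 0 sorry):
* §2 **`exists_family_on_tower`** (THE `G` INSTANCE, def-free reading: for every storey-indexed `F k` on `towerTorus Lc M k` there is a torus-indexed `G` with
  `G (towerTorus Lc M k) = F k` for EVERY `k` and `G T = 0` off the tower — witness leaf-06 g38's NAMED `TorusCompositeCompanionFamilyG.onTowerFamily Lc M F`, the OWNER's W-FP-33-4),
  `transpose_of_tower` ∕ `transpose_eq_of_tower` (odd ∕ even parity passes from the prescription to the family), `family_eq_of_tower` ∕ `family_linear_of_tower` (the two clauses DETERMINE the family ⟹ uniqueness, linearity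
  in the prescription), **`exists_companion_functional`** (the instance as ONE function `Gf M F` of the data — what a door displaying `H₁f B v` as a linear FUNCTION of the
  direction consumes with one `obtain`), `eq_onTowerFamily_of_tower` (uniqueness in named form), `compSumSym_congr_of_tower` (`compSumSym Lc G M lev rs n` reads `G` only on the storey tori `k < n`),
  `compSumSym_transpose_of_symm` (the EVEN twin of g44's `compSumSym_transpose_of_antisymm` — the companion-sum half of a door's `hH₂t`).
* §3 the Λ member's parity AT ANY BLOCKING `N`, ROOT `ρ`, SCALE `L` (the closing's currency `SLam N (cf k) (fun μ y => symHessFFAt ρ_c Lc μ y)`; an2's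
  `CombLamSectorPeriodised.torus_Lam_family_transpose` is the instance `N = Lc`, `ρ = ctr (d+1) Lc`): `trF_SLam_symHessFFAt` (termwise `symHessFFAt_antisymm` under
  `cwsum_apply`), `torus_Lam_member_transpose` (`PeriodisedIndexLawSummable.perF_dper_transpose_of_trF`), `torus_Lam_family_sum_transpose` (the weighted family).
* §4 **`tower_H1_total_transpose`** — the door's parity `hH₁t : H₁ᵀ = −H₁` AT THE TOTAL SLOT `H₁ := (−2cW) • Σ_b hb b • W_b|ff + w • Σ_ā hb ā • Λ_ā|ff + compSumSym Lc G M lev rs n`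
  for ANY antisymmetric companion family (`PeriodisedFormIndexWardDoubled.torus_H1_transpose` + §3 + leaf-05 g44 `PeriodisedWardOrderOneTowerStep.compSumSym_transpose_of_antisymm`)
  — R-FP-74's «`hH₁t` from the members' parities» (`GradedFormParity.K1t_of_graded`'s pattern) for the tower.
* §5 AT THE NAMED FAMILY `G := onTowerFamily Lc M (fun k => w k • Σ_ā hb k ā • Λ_ā|ff)`: `onTowerFamily_lam_transpose` (antisymmetric on every torus — the `hGt` of §4 and of
  g44's `compSumSym_transpose_of_antisymm`) and **`tower_a1_row_towerGen_eq_zero_onTowerFamily`** — `tower_a1_row_towerGen_eq_zero` WITH `G` WRITTEN AND `hG` DISCHARGED (`2 ≤ Lc`):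
  `((−2cW) • Σ W + HL_n + compSumSym Lc (onTowerFamily Lc M F) M lev ρs n) * towerGen Lc M ρs n + H₀ * W₁ = 0` (`Y₁ = 0`) — UNDER the displayed (K1) and the `n` links
  (the nested column's KKT letters; the row's ∕ the dictionary's, unchanged from the closing).
WHAT THIS IS NOT: the identification of an2's composite Λ word (`cΛ • SLam N (lamCoeffOf (KInv N) N) compH` contracted by `colH (AN R j)`, F6d-2) with
X and the packing at the pass is the ROAD's (R-FP-75) — nothing of either is typed here; (K1) and
the links stay DISPLAYED; no row of the door is discharged by this file alone; the `def` itself is leaf-06's file (imported).  0 estimates; 0∕4 row-D1 binders (hW, hR, D1Tel, D1Rep); ROOT M‴ p325680 untouched; NOT (C1), NOT (T-ID), NOT SDF, NOT D1, NEVER «G-an2-4 closed»,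
NOT BetaPertH, NOT continuum, NOT Clay.  «not in print; our bookkeeping».

HONEST DEPENDENCY (page 1, mandatory): continuum YM on T⁴ ⇐ BetaPertH ∧ nine spine estimates (0/9 proved); BetaPertH ⇐ (D1) ∧ (D4) ∧ CAP+tail;
G-an2-4 gates asym, D1 and NE2/3/4.  HONEST FRAMING (cell contract, verbatim): «discharging `BetaPertH` makes Bałaban's UV stability UNCONDITIONAL —
a real constructive-QFT result; it is NOT the continuum limit and NOT the Clay problem.»  ABSOLUTE RULE (cell charter, verbatim): «No internally-minted
statement may enter as a cited fact. Every hypothesis is either kernel-proved in this package or a verbatim quotation of a PUBLISHED theorem with page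
reference. The manuscript(s) under audit are NOT citable for their own disputed steps — they are the thing under adjudication; programme-internal
(2001/route/tribunal) claims are never citable.»  Nothing of Bałaban's ∕ the dictionary's asserted, valued or discharged.
Unit `b2b-balaban-beta-d1-formalise-leaf-05` (gen 45), 2026-08-25; no existing file touched.
-/

noncomputable section

namespace Summit.QuantumFields.BalabanUV.Beta.FP.TowerCompanionInstance

open scoped BigOperators Matrix
open Finset Matrix
open Literature.MathematicalPhysics.QuantumFieldTheory.Balaban1983to89
open Literature.MathematicalPhysics.QuantumFieldTheory.Balaban1983to89.Beta
open B4TorusKernel.MultiPeriod (translate translate_apply)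
open B5Prop11Plancherel (fine)
open B6Lemma24Torus (pbox mem_pbox)
open AffineAveraging (Site box toSite unitVec)
open AveragingContoursRooted (ctr ctrOff ctrOff_mem_box)
open OneStepResolventKernel (Fib)
open InterLevelTransport (SLam cwsum_apply)
open StepJetData (wilsonA)
open Summit.QuantumFields.BalabanUV.Beta.SymAveragingHessianCounts (symHessFFAt symHessFFAt_antisymm symLinKerAt)
open Summit.QuantumFields.BalabanUV.Beta.BorderedHessian (bhKStepAt stepScale)
open Summit.QuantumFields.BalabanUV.Beta.FP.KernelPeriodisationFib (Idx perF perF_apply perZ perZ_apply trF)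
open Summit.QuantumFields.BalabanUV.Beta.FP.KernelPeriodisationFibLoc (dper)
open Summit.QuantumFields.BalabanUV.Beta.PeriodisedIndexLawSummable (perF_dper_transpose_of_trF)
open Summit.QuantumFields.BalabanUV.Beta.FP.PeriodisedFormIndexWardDoubled (torus_H1_transpose)
open Summit.QuantumFields.BalabanUV.Beta.FP.TorusGaugeCovariancePairing (wrapPt)
open Summit.QuantumFields.BalabanUV.Beta.FP.TorusCompositeObjects (towerTorus towerTorus_apply towerTorus_zero NParam towerGen)
open Summit.QuantumFields.BalabanUV.Beta.FP.TorusCompositeObjectsG (QstepSym compRowsSym)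
open Summit.QuantumFields.BalabanUV.Beta.FP.TorusCompositeCovariance (itRoot)
open Summit.QuantumFields.BalabanUV.Beta.FP.TorusCompositeFP (evalN)
open Summit.QuantumFields.BalabanUV.Beta.FP.TorusCompositeCompanionSumG (onTower compSumG compSumSym compSumSym_zero compSumSym_succ)
open Summit.QuantumFields.BalabanUV.Beta.FP.PeriodisedWardOrderOneTowerStep (compSumSym_transpose_of_antisymm)
open Summit.QuantumFields.BalabanUV.Beta.FP.PeriodisedWardOrderOneTowerClosing (tower_a1_row_towerGen_eq_zero)
open Summit.QuantumFields.BalabanUV.Beta.FP.TorusCompositeCompanionFamilyG (towerTorus_injective onTowerFamily onTowerFamily_towerTorus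
  onTowerFamily_eq_zero onTowerFamily_transpose)

variable {d : ℕ} (Lc : ℕ) (N : ℕ)

/-! ## §2 THE `G` INSTANCE: every storey-indexed family of matrices is the restriction of a torus-indexed one (leaf-06's NAMED `onTowerFamily`) -/

/-- **[our object — bookkeeping] `exists_family_on_tower` — THE `G` INSTANCE (R-FP-75, J-RISK-3′ «leaf-05: the `G` instance»).**  For `2 ≤ Lc`, a top torus `M`
and ANY storey-indexed prescription `F k : Matrix (↥(pbox (towerTorus Lc M k)) × Fin (d+1)) (same) ℝ`, there is a TORUS-indexed family `G` (leaf-06's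
`compSumG ∕ compSumSym` indexing) with `G (towerTorus Lc M k) = F k` for EVERY storey `k` and `G T = 0` on every torus off the tower.  WITNESS: leaf-06 g38's NAMED
extension by zero `TorusCompositeCompanionFamilyG.onTowerFamily Lc M F` (the OWNER's W-FP-33-4: the pass WRITES the companion family in statements; this ∃ form is its
def-free corollary — `onTowerFamily_towerTorus` (injectivity of the storey tori, `2 ≤ Lc`) + `onTowerFamily_eq_zero`). -/
theorem exists_family_on_tower (hLc : 2 ≤ Lc) (M : Fin (d + 1) → ℕ) [∀ μ, NeZero (M μ)]
    (F : (k : ℕ) → Matrix (↥(pbox (towerTorus Lc M k)) × Fin (d + 1)) (↥(pbox (towerTorus Lc M k)) × Fin (d + 1)) ℝ) :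
    ∃ G : (T : Fin (d + 1) → ℕ) → Matrix (↥(pbox T) × Fin (d + 1)) (↥(pbox T) × Fin (d + 1)) ℝ,
      (∀ k, G (towerTorus Lc M k) = F k) ∧ (∀ T, (∀ k, towerTorus Lc M k ≠ T) → G T = 0) :=
  ⟨onTowerFamily Lc M F, onTowerFamily_towerTorus Lc hLc M F, onTowerFamily_eq_zero Lc M F⟩

/-- [folklore] **`transpose_of_tower`** — parity passes from the prescription to the instance: if every prescribed storey member is antisymmetric then so is every
member of a torus-indexed family that restricts to it on the tower and vanishes off it. -/
theorem transpose_of_tower {M : Fin (d + 1) → ℕ}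
    {G : (T : Fin (d + 1) → ℕ) → Matrix (↥(pbox T) × Fin (d + 1)) (↥(pbox T) × Fin (d + 1)) ℝ}
    {F : (k : ℕ) → Matrix (↥(pbox (towerTorus Lc M k)) × Fin (d + 1)) (↥(pbox (towerTorus Lc M k)) × Fin (d + 1)) ℝ}
    (hGi : ∀ k, G (towerTorus Lc M k) = F k) (hGo : ∀ T, (∀ k, towerTorus Lc M k ≠ T) → G T = 0)
    (hF : ∀ k, (F k)ᵀ = -F k) (T : Fin (d + 1) → ℕ) : (G T)ᵀ = -G T := by
  by_cases h : ∃ k, towerTorus Lc M k = T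
  · obtain ⟨k, rfl⟩ := h
    rw [hGi]
    exact hF k
  · rw [hGo T (fun k hk => h ⟨k, hk⟩), Matrix.transpose_zero, neg_zero]

/-- [folklore] **`transpose_eq_of_tower`** — the EVEN twin of `transpose_of_tower`: symmetric prescribed storey members give a family symmetric on every
torus (the shape of an order-2 companion family `G₂`, `GradedFormParity.K2t_of_graded`'s input `G₂ᵀ = G₂`). -/
theorem transpose_eq_of_tower {M : Fin (d + 1) → ℕ}
    {G : (T : Fin (d + 1) → ℕ) → Matrix (↥(pbox T) × Fin (d + 1)) (↥(pbox T) × Fin (d + 1)) ℝ}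
    {F : (k : ℕ) → Matrix (↥(pbox (towerTorus Lc M k)) × Fin (d + 1)) (↥(pbox (towerTorus Lc M k)) × Fin (d + 1)) ℝ}
    (hGi : ∀ k, G (towerTorus Lc M k) = F k) (hGo : ∀ T, (∀ k, towerTorus Lc M k ≠ T) → G T = 0)
    (hF : ∀ k, (F k)ᵀ = F k) (T : Fin (d + 1) → ℕ) : (G T)ᵀ = G T := by
  by_cases h : ∃ k, towerTorus Lc M k = T
  · obtain ⟨k, rfl⟩ := h
    rw [hGi]
    exact hF k
  · rw [hGo T (fun k hk => h ⟨k, hk⟩), Matrix.transpose_zero]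

/-- [folklore] **`family_eq_of_tower`** — the tower restriction and the vanishing off the tower DETERMINE a torus-indexed family (every torus is on or off
the tower): two families with the same storey values that both vanish off the tower are EQUAL.  (So the instance of `exists_family_on_tower` is unique, and
every property of the prescription that is stable under these two clauses — linearity in the data, parity — passes to it.) -/
theorem family_eq_of_tower {M : Fin (d + 1) → ℕ}
    {G G' : (T : Fin (d + 1) → ℕ) → Matrix (↥(pbox T) × Fin (d + 1)) (↥(pbox T) × Fin (d + 1)) ℝ}
    {F : (k : ℕ) → Matrix (↥(pbox (towerTorus Lc M k)) × Fin (d + 1)) (↥(pbox (towerTorus Lc M k)) × Fin (d + 1)) ℝ}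
    (hG : ∀ k, G (towerTorus Lc M k) = F k) (hGo : ∀ T, (∀ k, towerTorus Lc M k ≠ T) → G T = 0)
    (hG' : ∀ k, G' (towerTorus Lc M k) = F k) (hG'o : ∀ T, (∀ k, towerTorus Lc M k ≠ T) → G' T = 0) : G = G' := by
  funext T
  by_cases h : ∃ k, towerTorus Lc M k = T
  · obtain ⟨k, rfl⟩ := h
    rw [hG, hG']
  · rw [hGo T (fun k hk => h ⟨k, hk⟩), hG'o T (fun k hk => h ⟨k, hk⟩)]

/-- [folklore] **`family_linear_of_tower`** — LINEARITY IN THE PRESCRIPTION: if `G₁ ∕ G₂ ∕ G₃` extend `F₁ ∕ F₂ ∕ r • F₁ + F₂` (zero off the tower) then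
`G₃ = r • G₁ + G₂` (`family_eq_of_tower`) — what a door displaying the first-order form jet as a LINEAR function of the direction (#42a-Sym's `hH₁l`) consumes,
together with leaf-06's `compSumG_add ∕ compSumG_smul`. -/
theorem family_linear_of_tower {M : Fin (d + 1) → ℕ}
    {G₁ G₂ G₃ : (T : Fin (d + 1) → ℕ) → Matrix (↥(pbox T) × Fin (d + 1)) (↥(pbox T) × Fin (d + 1)) ℝ}
    {F₁ F₂ : (k : ℕ) → Matrix (↥(pbox (towerTorus Lc M k)) × Fin (d + 1)) (↥(pbox (towerTorus Lc M k)) × Fin (d + 1)) ℝ} (r : ℝ)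
    (h₁ : ∀ k, G₁ (towerTorus Lc M k) = F₁ k) (h₁o : ∀ T, (∀ k, towerTorus Lc M k ≠ T) → G₁ T = 0)
    (h₂ : ∀ k, G₂ (towerTorus Lc M k) = F₂ k) (h₂o : ∀ T, (∀ k, towerTorus Lc M k ≠ T) → G₂ T = 0)
    (h₃ : ∀ k, G₃ (towerTorus Lc M k) = r • F₁ k + F₂ k) (h₃o : ∀ T, (∀ k, towerTorus Lc M k ≠ T) → G₃ T = 0) :
    G₃ = r • G₁ + G₂ :=
  family_eq_of_tower Lc h₃ h₃o (fun k => by rw [Pi.add_apply, Pi.smul_apply, h₁, h₂])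
    (fun T hT => by rw [Pi.add_apply, Pi.smul_apply, h₁o T hT, h₂o T hT, smul_zero, add_zero])

/-- [folklore] **`eq_onTowerFamily_of_tower`** — UNIQUENESS IN NAMED FORM: every torus-indexed family that restricts to `F` on the tower and vanishes off it
IS leaf-06's `onTowerFamily Lc M F` (`2 ≤ Lc`). -/
theorem eq_onTowerFamily_of_tower (hLc : 2 ≤ Lc) (M : Fin (d + 1) → ℕ) [∀ μ, NeZero (M μ)]
    (F : (k : ℕ) → Matrix (↥(pbox (towerTorus Lc M k)) × Fin (d + 1)) (↥(pbox (towerTorus Lc M k)) × Fin (d + 1)) ℝ)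
    {G : (T : Fin (d + 1) → ℕ) → Matrix (↥(pbox T) × Fin (d + 1)) (↥(pbox T) × Fin (d + 1)) ℝ}
    (hG : ∀ k, G (towerTorus Lc M k) = F k) (hGo : ∀ T, (∀ k, towerTorus Lc M k ≠ T) → G T = 0) : G = onTowerFamily Lc M F :=
  family_eq_of_tower Lc hG hGo (onTowerFamily_towerTorus Lc hLc M F) (onTowerFamily_eq_zero Lc M F)

/-- **[our object — bookkeeping] `exists_companion_functional` — THE `G` INSTANCE AS ONE FUNCTION OF THE DATA (def-free; `2 ≤ Lc`).**  There is a map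
`Gf : (top torus M) → (storey prescription F) → (torus-indexed family)` such that, for every top `M` with positive sides and every `F`, `Gf M F` restricts to `F`
on the tower and vanishes off it.  A door that displays the first-order form jet as a FUNCTION of the direction (#42a-Sym: `H₁f B v`, linear by `hH₁l`) takes
ONE `obtain ⟨Gf, hGf⟩` and writes the companion family of direction `v` as `Gf (M′ B) (F B v)`; `hG`, the vanishing off the tower, linearity
(`family_linear_of_tower`) and parity (`transpose_of_tower`) are then read off `hGf`.  WITNESS: `fun M F => onTowerFamily Lc M F` (leaf-06's `def`, the OWNER's W-FP-33-4). -/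
theorem exists_companion_functional (hLc : 2 ≤ Lc) :
    ∃ Gf : (M : Fin (d + 1) → ℕ) →
        ((k : ℕ) → Matrix (↥(pbox (towerTorus Lc M k)) × Fin (d + 1)) (↥(pbox (towerTorus Lc M k)) × Fin (d + 1)) ℝ) →
          (T : Fin (d + 1) → ℕ) → Matrix (↥(pbox T) × Fin (d + 1)) (↥(pbox T) × Fin (d + 1)) ℝ,
      ∀ (M : Fin (d + 1) → ℕ), (∀ μ, NeZero (M μ)) →
        ∀ F : (k : ℕ) → Matrix (↥(pbox (towerTorus Lc M k)) × Fin (d + 1)) (↥(pbox (towerTorus Lc M k)) × Fin (d + 1)) ℝ,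
          (∀ k, Gf M F (towerTorus Lc M k) = F k) ∧ (∀ T, (∀ k, towerTorus Lc M k ≠ T) → Gf M F T = 0) :=
  ⟨fun M F => onTowerFamily Lc M F, fun M hM F => ⟨@onTowerFamily_towerTorus d Lc hLc M hM F, onTowerFamily_eq_zero Lc M F⟩⟩

/-- [folklore] **`compSumSym_congr_of_tower`** — UNIQUENESS WHERE IT MATTERS: leaf-06's companion sum of depth `n` reads the family ONLY on the storey tori
`towerTorus Lc M k`, `k < n`; two torus-indexed families that agree there have the same `compSumSym Lc · M lev rs n` (push-inside induction along `compSumSym_succ`;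
`towerTorus_zero ∕ _succ` are `rfl`).  With `exists_family_on_tower` this makes the instance unique up to values off the tower. -/
theorem compSumSym_congr_of_tower [NeZero Lc]
    (G G' : (T : Fin (d + 1) → ℕ) → Matrix (↥(pbox T) × Fin (d + 1)) (↥(pbox T) × Fin (d + 1)) ℝ) :
    ∀ (n : ℕ) (M : Fin (d + 1) → ℕ) [∀ μ, NeZero (M μ)] (lev : ℕ → ℕ) (rs : ℕ → (Fin (d + 1) → ℕ)),
      (∀ k, k < n → G (towerTorus Lc M k) = G' (towerTorus Lc M k)) →
        compSumSym Lc G M lev rs n = compSumSym Lc G' M lev rs n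
  | 0, M, _, lev, rs, _ => by rw [compSumSym_zero, compSumSym_zero]
  | n + 1, M, _, lev, rs, h => by
    have h0 : G M = G' M := h 0 (Nat.succ_pos n)
    rw [compSumSym_succ, compSumSym_succ, h0,
      compSumSym_congr_of_tower G G' n (fine Lc M) (fun k => lev (k + 1)) (fun k => rs (k + 1))
        (fun k hk => h (k + 1) (Nat.succ_lt_succ hk))]

/-- [folklore] **`compSumSym_transpose_of_symm`** — the EVEN twin of leaf-05 g44's `PeriodisedWardOrderOneTowerStep.compSumSym_transpose_of_antisymm`:
a companion family SYMMETRIC on every torus has a symmetric companion sum at every depth (`(Pᵀ G P)ᵀ = Pᵀ Gᵀ P`, push-inside along `compSumSym_succ`) — the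
companion-sum half of a door's `hH₂t` in `GradedFormParity.K2t_of_graded`'s pattern. -/
theorem compSumSym_transpose_of_symm [NeZero Lc]
    (G : (T : Fin (d + 1) → ℕ) → Matrix (↥(pbox T) × Fin (d + 1)) (↥(pbox T) × Fin (d + 1)) ℝ) (hGt : ∀ T, (G T)ᵀ = G T) :
    ∀ (n : ℕ) (M : Fin (d + 1) → ℕ) [∀ μ, NeZero (M μ)] (lev : ℕ → ℕ) (rs : ℕ → (Fin (d + 1) → ℕ)),
      (compSumSym Lc G M lev rs n)ᵀ = compSumSym Lc G M lev rs n
  | 0, M, _, lev, rs => by rw [compSumSym_zero, Matrix.transpose_zero]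
  | n + 1, M, _, lev, rs => by
    rw [compSumSym_succ, Matrix.transpose_add, Matrix.transpose_mul, Matrix.transpose_mul, Matrix.transpose_transpose, hGt, Matrix.mul_assoc]
    congr 1
    exact compSumSym_transpose_of_symm G hGt n (fine Lc M) (fun k => lev (k + 1)) (fun k => rs (k + 1))

/-! ## §3 The Λ member's parity at any blocking, root and scale (the closing's currency) -/

/-- [folklore] **`trF_SLam_symHessFFAt`** — a Λ-sector member built on an1's symmetrised constraint Hessian is FIBRE-TRANSPOSE-ODD as a whole kernel, for ANY
blocking `N`, root `ρ`, scale `L`, conversion coefficients `c`: `trF (SLam N c (symHessFFAt ρ L) κ u) = −SLam N c (symHessFFAt ρ L) κ u` (termwise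
`symHessFFAt_antisymm` under `cwsum_apply`; an2's `CombLamSectorPeriodised.trF_SLam_an1TablesS2` is the instance `N = Lc`, `ρ = ctr (d+1) Lc`, `L = Lc`). -/
theorem trF_SLam_symHessFFAt [NeZero N] (ρ : Site (d + 1)) (L : ℕ)
    (c : Fin (d + 1) → Site (d + 1) → Fin (d + 1) → Site (d + 1) → ℝ) (κ : Fin (d + 1)) (u : Site (d + 1)) :
    trF (SLam N c (fun μ y => symHessFFAt ρ L μ y) κ u) = -SLam N c (fun μ y => symHessFFAt ρ L μ y) κ u := by
  funext x z a b
  have h : ∀ (μ : Fin (d + 1)) (y : Site (d + 1)),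
      c μ y κ u * symHessFFAt ρ L μ y z x b a = -(c μ y κ u * symHessFFAt ρ L μ y x z a b) := fun μ y => by
    rw [symHessFFAt_antisymm ρ L μ y x z a b, mul_neg]
  simp only [trF, SLam, Pi.neg_apply, cwsum_apply, h, tsum_neg, Finset.sum_neg_distrib, neg_neg]

/-- [folklore] **`torus_Lam_member_transpose`** — hence its periodisation on ANY torus `T` is an antisymmetric matrix on the field index:
`(Λ_ā|ff)ᵀ = −Λ_ā|ff`, `Λ_ā := perF T (dper T (SLam N c (symHessFFAt ρ L) ā.2 ↑ā.1))` (`PeriodisedIndexLawSummable.perF_dper_transpose_of_trF`). -/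
theorem torus_Lam_member_transpose (T : Fin (d + 1) → ℕ) [∀ μ, NeZero (T μ)] [NeZero N] (ρ : Site (d + 1)) (L : ℕ)
    (c : Fin (d + 1) → Site (d + 1) → Fin (d + 1) → Site (d + 1) → ℝ) (ā : ↥(pbox T) × Fin (d + 1)) :
    ((perF T (dper T (SLam N c (fun μ y => symHessFFAt ρ L μ y) ā.2 (ā.1 : Site (d + 1))))).submatrix
        (fun b : ↥(pbox T) × Fin (d + 1) => ((b.1, Sum.inl b.2) : Idx T (Fib d)))
        (fun b : ↥(pbox T) × Fin (d + 1) => ((b.1, Sum.inl b.2) : Idx T (Fib d))))ᵀ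
      = -(perF T (dper T (SLam N c (fun μ y => symHessFFAt ρ L μ y) ā.2 (ā.1 : Site (d + 1))))).submatrix
        (fun b : ↥(pbox T) × Fin (d + 1) => ((b.1, Sum.inl b.2) : Idx T (Fib d)))
        (fun b : ↥(pbox T) × Fin (d + 1) => ((b.1, Sum.inl b.2) : Idx T (Fib d))) := by
  rw [Matrix.transpose_submatrix, perF_dper_transpose_of_trF _ (trF_SLam_symHessFFAt N ρ L c ā.2 (ā.1 : Site (d + 1)))]
  rfl

/-- [folklore] **`torus_Lam_family_sum_transpose`** — THE WEIGHTED Λ FAMILY ALONG ANY DIRECTION IS ANTISYMMETRIC: `(w • Σ_ā hb ā • Λ_ā|ff)ᵀ = −(w • Σ_ā hb ā • Λ_ā|ff)`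
(any torus, blocking, root, scale, coefficients, weight `w`, bond weights `hb`) — the shape of the closing's `hG k` right-hand sides and of its bottom table `HL_n`. -/
theorem torus_Lam_family_sum_transpose (T : Fin (d + 1) → ℕ) [∀ μ, NeZero (T μ)] [NeZero N] (ρ : Site (d + 1)) (L : ℕ)
    (c : Fin (d + 1) → Site (d + 1) → Fin (d + 1) → Site (d + 1) → ℝ) (w : ℝ) (hb : ↥(pbox T) × Fin (d + 1) → ℝ) :
    (w • ∑ ā : ↥(pbox T) × Fin (d + 1), hb ā •
        (perF T (dper T (SLam N c (fun μ y => symHessFFAt ρ L μ y) ā.2 (ā.1 : Site (d + 1))))).submatrix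
          (fun b : ↥(pbox T) × Fin (d + 1) => ((b.1, Sum.inl b.2) : Idx T (Fib d)))
          (fun b : ↥(pbox T) × Fin (d + 1) => ((b.1, Sum.inl b.2) : Idx T (Fib d))))ᵀ
      = -(w • ∑ ā : ↥(pbox T) × Fin (d + 1), hb ā •
        (perF T (dper T (SLam N c (fun μ y => symHessFFAt ρ L μ y) ā.2 (ā.1 : Site (d + 1))))).submatrix
          (fun b : ↥(pbox T) × Fin (d + 1) => ((b.1, Sum.inl b.2) : Idx T (Fib d)))
          (fun b : ↥(pbox T) × Fin (d + 1) => ((b.1, Sum.inl b.2) : Idx T (Fib d)))) := by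
  rw [Matrix.transpose_smul, Matrix.transpose_sum, ← smul_neg, ← Finset.sum_neg_distrib]
  congr 1
  exact Finset.sum_congr rfl fun ā _ => by rw [Matrix.transpose_smul, torus_Lam_member_transpose, smul_neg]

/-! ## §4 The door's parity `hH₁t` at the TOTAL slot -/

/-- **[folklore] `tower_H1_total_transpose` — THE DOOR's `hH₁t : H₁ᵀ = −H₁` AT THE TOTAL SLOT** `H₁ := (−2cW) • Σ_b hb b • W_b|ff + w • Σ_ā hb ā • Λ_ā|ff + compSumSym Lc G M lev rs n`
(Wilson family + the bottom Λ table + the storeys' companion sum, the `H₁` of `tower_a1_row_towerGen_eq_zero`), for ANY companion family antisymmetric on every torus: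
Wilson half by `PeriodisedFormIndexWardDoubled.torus_H1_transpose`, Λ half by §3, companion sum by leaf-05 g44's `PeriodisedWardOrderOneTowerStep.compSumSym_transpose_of_antisymm`
(R-FP-74: «`hH₁t` … from the members' parities», `GradedFormParity.K1t_of_graded`'s pattern). -/
theorem tower_H1_total_transpose [NeZero Lc] [NeZero N]
    (G : (T : Fin (d + 1) → ℕ) → Matrix (↥(pbox T) × Fin (d + 1)) (↥(pbox T) × Fin (d + 1)) ℝ) (hGt : ∀ T, (G T)ᵀ = -G T)
    (n : ℕ) (M : Fin (d + 1) → ℕ) [∀ μ, NeZero (M μ)] (lev : ℕ → ℕ) (rs : ℕ → (Fin (d + 1) → ℕ))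
    (cf : Fin (d + 1) → Site (d + 1) → Fin (d + 1) → Site (d + 1) → ℝ) (w cW : ℝ)
    (hb : ↥(pbox (towerTorus Lc M n)) × Fin (d + 1) → ℝ) :
    (((-2 * cW) • ∑ b : ↥(pbox (towerTorus Lc M n)) × Fin (d + 1), hb b •
          (perF (towerTorus Lc M n) (dper (towerTorus Lc M n) (wilsonA d b.2 (b.1 : Site (d + 1))))).submatrix
            (fun b : ↥(pbox (towerTorus Lc M n)) × Fin (d + 1) => ((b.1, Sum.inl b.2) : Idx (towerTorus Lc M n) (Fib d)))
            (fun b : ↥(pbox (towerTorus Lc M n)) × Fin (d + 1) => ((b.1, Sum.inl b.2) : Idx (towerTorus Lc M n) (Fib d))))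
        + w • ∑ ā : ↥(pbox (towerTorus Lc M n)) × Fin (d + 1), hb ā •
            (perF (towerTorus Lc M n) (dper (towerTorus Lc M n) (SLam N cf (fun μ y => symHessFFAt (toSite (ctrOff (d + 1) Lc)) Lc μ y) ā.2 (ā.1 : Site (d + 1))))).submatrix
              (fun b : ↥(pbox (towerTorus Lc M n)) × Fin (d + 1) => ((b.1, Sum.inl b.2) : Idx (towerTorus Lc M n) (Fib d)))
              (fun b : ↥(pbox (towerTorus Lc M n)) × Fin (d + 1) => ((b.1, Sum.inl b.2) : Idx (towerTorus Lc M n) (Fib d)))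
        + compSumSym Lc G M lev rs n)ᵀ
      = -(((-2 * cW) • ∑ b : ↥(pbox (towerTorus Lc M n)) × Fin (d + 1), hb b •
          (perF (towerTorus Lc M n) (dper (towerTorus Lc M n) (wilsonA d b.2 (b.1 : Site (d + 1))))).submatrix
            (fun b : ↥(pbox (towerTorus Lc M n)) × Fin (d + 1) => ((b.1, Sum.inl b.2) : Idx (towerTorus Lc M n) (Fib d)))
            (fun b : ↥(pbox (towerTorus Lc M n)) × Fin (d + 1) => ((b.1, Sum.inl b.2) : Idx (towerTorus Lc M n) (Fib d))))
        + w • ∑ ā : ↥(pbox (towerTorus Lc M n)) × Fin (d + 1), hb ā •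
            (perF (towerTorus Lc M n) (dper (towerTorus Lc M n) (SLam N cf (fun μ y => symHessFFAt (toSite (ctrOff (d + 1) Lc)) Lc μ y) ā.2 (ā.1 : Site (d + 1))))).submatrix
              (fun b : ↥(pbox (towerTorus Lc M n)) × Fin (d + 1) => ((b.1, Sum.inl b.2) : Idx (towerTorus Lc M n) (Fib d)))
              (fun b : ↥(pbox (towerTorus Lc M n)) × Fin (d + 1) => ((b.1, Sum.inl b.2) : Idx (towerTorus Lc M n) (Fib d)))
        + compSumSym Lc G M lev rs n) := by
  rw [Matrix.transpose_add, Matrix.transpose_add, Matrix.transpose_smul, torus_H1_transpose, torus_Lam_family_sum_transpose,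
    compSumSym_transpose_of_antisymm Lc G hGt, smul_neg, neg_add, neg_add]

/-! ## §5 At the NAMED companion family: parity, and the closing with `G ∕ hG` DISCHARGED -/

/-- [folklore] **`onTowerFamily_lam_transpose`** — THE NAMED COMPANION FAMILY OF THE STOREYS' Λ-FAMILIES IS ANTISYMMETRIC ON EVERY TORUS (any blocking `N`,
weights `w k`, directions `hb k`, coefficients `cf k`; no hypothesis on `Lc`): leaf-06's `onTowerFamily_transpose` fed §3's `torus_Lam_family_sum_transpose` —
the `hGt` input of `tower_H1_total_transpose` (the door's `hH₁t` at the total slot with the companions WRITTEN) and of g44's `compSumSym_transpose_of_antisymm`. -/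
theorem onTowerFamily_lam_transpose [NeZero Lc] [NeZero N] (M : Fin (d + 1) → ℕ) [∀ μ, NeZero (M μ)]
    (cf : ℕ → (Fin (d + 1) → Site (d + 1) → Fin (d + 1) → Site (d + 1) → ℝ)) (w : ℕ → ℝ)
    (hb : (k : ℕ) → (↥(pbox (towerTorus Lc M k)) × Fin (d + 1) → ℝ)) (T : Fin (d + 1) → ℕ) :
    (onTowerFamily Lc M (fun k => w k • ∑ ā : ↥(pbox (towerTorus Lc M k)) × Fin (d + 1), hb k ā •
            (perF (towerTorus Lc M k) (dper (towerTorus Lc M k) (SLam N (cf k) (fun μ y => symHessFFAt (toSite (ctrOff (d + 1) Lc)) Lc μ y) ā.2 (ā.1 : Site (d + 1))))).submatrix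
              (fun b : ↥(pbox (towerTorus Lc M k)) × Fin (d + 1) => ((b.1, Sum.inl b.2) : Idx (towerTorus Lc M k) (Fib d)))
              (fun b : ↥(pbox (towerTorus Lc M k)) × Fin (d + 1) => ((b.1, Sum.inl b.2) : Idx (towerTorus Lc M k) (Fib d)))) T)ᵀ
      = -onTowerFamily Lc M (fun k => w k • ∑ ā : ↥(pbox (towerTorus Lc M k)) × Fin (d + 1), hb k ā •
            (perF (towerTorus Lc M k) (dper (towerTorus Lc M k) (SLam N (cf k) (fun μ y => symHessFFAt (toSite (ctrOff (d + 1) Lc)) Lc μ y) ā.2 (ā.1 : Site (d + 1))))).submatrix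
              (fun b : ↥(pbox (towerTorus Lc M k)) × Fin (d + 1) => ((b.1, Sum.inl b.2) : Idx (towerTorus Lc M k) (Fib d)))
              (fun b : ↥(pbox (towerTorus Lc M k)) × Fin (d + 1) => ((b.1, Sum.inl b.2) : Idx (towerTorus Lc M k) (Fib d)))) T :=
  onTowerFamily_transpose Lc M _
    (fun k => torus_Lam_family_sum_transpose N (towerTorus Lc M k) (toSite (ctrOff (d + 1) Lc)) Lc (cf k) (w k) (hb k)) T

/-- **[folklore] `tower_a1_row_towerGen_eq_zero_onTowerFamily` — THE TOWER's `a1` ROW AT THE RECORD's COLUMNS CLOSES TO ZERO WITH THE COMPANIONS WRITTEN (`2 ≤ Lc`).**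
`PeriodisedWardOrderOneTowerClosing.tower_a1_row_towerGen_eq_zero` (every binder VERBATIM: depth `n`, top `M`, levels `lev`, storey data from the top `Ma hMa cf hcf w κ hκ hκn hb`,
bottom `ρ L cW`, the displayed (K1) and the `n` links) AT THE NAMED COMPANION FAMILY `G := onTowerFamily Lc M (fun k => w k • Σ_ā hb k ā • Λ_ā|ff)` (leaf-06 g38's
`def`, the OWNER's W-FP-33-4), the identifications `hG k` DISCHARGED by `onTowerFamily_towerTorus` (storey tori injective, `2 ≤ Lc`):
`((−2cW) • Σ W + HL_n + compSumSym Lc (onTowerFamily Lc M F) M lev ρs n) * towerGen Lc M ρs n + H₀|ff * W₁ = 0`, `Y₁ = 0`.  The door's `hH₁t` at the same slot is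
`tower_H1_total_transpose Lc N _ (onTowerFamily_lam_transpose …) …`; the ∃-packaging of both is the one-line corollary `⟨onTowerFamily Lc M F, onTowerFamily_towerTorus …, …⟩`.
(K1) and the links stay DISPLAYED (the nested column's KKT letters — the row's); the identification of the dictionary's composite Λ word with `HL_n + compSumSym Lc (onTowerFamily Lc M F) …`
is the ROW's third of J-RISK-3′ (an2), the packing the ROAD's. -/
theorem tower_a1_row_towerGen_eq_zero_onTowerFamily [NeZero Lc] [NeZero N] (hLc : 2 ≤ Lc) (hc : ctrOff (d + 1) Lc ∈ box (d + 1) Lc) (n : ℕ)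
    (M : Fin (d + 1) → ℕ) [∀ μ, NeZero (M μ)]
    (lev : ℕ → ℕ) (Ma : ℕ → (Fin (d + 1) → ℕ)) (hMa : ∀ k i, towerTorus Lc M k i = Lc * Ma k i)
    (cf : ℕ → (Fin (d + 1) → Site (d + 1) → Fin (d + 1) → Site (d + 1) → ℝ))
    (hcf : ∀ k κ' u μ y, Summable fun m : Site (d + 1) => cf k μ (translate (Ma k) y m) κ' u)
    (w κ : ℕ → ℝ) (hκ : ∀ k, k < n → κ k = stepScale d Lc (lev (k + 1)) * ((box (d + 1) Lc).card : ℝ) * κ (k + 1)) (hκn : κ n = 1)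
    (hb : (k : ℕ) → (↥(pbox (towerTorus Lc M k)) × Fin (d + 1) → ℝ))
    (ρ : Site (d + 1)) (L : ℕ) [NeZero L] (cW : ℝ)
    (K1 : ∀ v : ↥(pbox (towerTorus Lc M n)) × Fin (d + 1),
      cW * ((perF (towerTorus Lc M n) (bhKStepAt d ρ L 0)).submatrix
          (fun b : ↥(pbox (towerTorus Lc M n)) × Fin (d + 1) => ((b.1, Sum.inl b.2) : Idx (towerTorus Lc M n) (Fib d)))
          (fun b : ↥(pbox (towerTorus Lc M n)) × Fin (d + 1) => ((b.1, Sum.inl b.2) : Idx (towerTorus Lc M n) (Fib d)))).mulVec (hb n) v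
        = w n * ∑ ā : ↥(pbox (towerTorus Lc M n)) × Fin (d + 1), hb n ā *
            ∑ μ : Fin (d + 1), ∑' y : Site (d + 1), (∑' m : Site (d + 1), cf n μ (translate (Ma n) y m) ā.2 (ā.1 : Site (d + 1)))
              * symLinKerAt (toSite (ctrOff (d + 1) Lc)) Lc μ y (v.2, (v.1 : Site (d + 1))))
    (hlink : ∀ k, k < n → ∀ a : ↥(pbox (towerTorus Lc M k)) × Fin (d + 1),
      w k * κ k * (∑ ā : ↥(pbox (towerTorus Lc M k)) × Fin (d + 1), hb k ā *
            ∑ μ : Fin (d + 1), ∑' y : Site (d + 1), (∑' m : Site (d + 1), cf k μ (translate (Ma k) y m) ā.2 (ā.1 : Site (d + 1)))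
              * symLinKerAt (toSite (ctrOff (d + 1) Lc)) Lc μ y (a.2, (a.1 : Site (d + 1))))
        = w (k + 1) * κ (k + 1) / (stepScale d Lc (lev (k + 1)) * (Lc : ℝ) ^ (d + 1)) *
          ∑ ā : ↥(pbox (towerTorus Lc M (k + 1))) × Fin (d + 1), hb (k + 1) ā *
            ∑' m : Site (d + 1), cf (k + 1) a.2 (translate (towerTorus Lc M k) (a.1 : Site (d + 1)) m) ā.2 (ā.1 : Site (d + 1))) :
    (((-2 * cW) • ∑ b : ↥(pbox (towerTorus Lc M n)) × Fin (d + 1), hb n b •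
          (perF (towerTorus Lc M n) (dper (towerTorus Lc M n) (wilsonA d b.2 (b.1 : Site (d + 1))))).submatrix
            (fun b : ↥(pbox (towerTorus Lc M n)) × Fin (d + 1) => ((b.1, Sum.inl b.2) : Idx (towerTorus Lc M n) (Fib d)))
            (fun b : ↥(pbox (towerTorus Lc M n)) × Fin (d + 1) => ((b.1, Sum.inl b.2) : Idx (towerTorus Lc M n) (Fib d))))
        + w n • ∑ ā : ↥(pbox (towerTorus Lc M n)) × Fin (d + 1), hb n ā •
            (perF (towerTorus Lc M n) (dper (towerTorus Lc M n) (SLam N (cf n) (fun μ y => symHessFFAt (toSite (ctrOff (d + 1) Lc)) Lc μ y) ā.2 (ā.1 : Site (d + 1))))).submatrix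
              (fun b : ↥(pbox (towerTorus Lc M n)) × Fin (d + 1) => ((b.1, Sum.inl b.2) : Idx (towerTorus Lc M n) (Fib d)))
              (fun b : ↥(pbox (towerTorus Lc M n)) × Fin (d + 1) => ((b.1, Sum.inl b.2) : Idx (towerTorus Lc M n) (Fib d)))
        + compSumSym Lc (onTowerFamily Lc M (fun k => w k • ∑ ā : ↥(pbox (towerTorus Lc M k)) × Fin (d + 1), hb k ā •
            (perF (towerTorus Lc M k) (dper (towerTorus Lc M k) (SLam N (cf k) (fun μ y => symHessFFAt (toSite (ctrOff (d + 1) Lc)) Lc μ y) ā.2 (ā.1 : Site (d + 1))))).submatrix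
              (fun b : ↥(pbox (towerTorus Lc M k)) × Fin (d + 1) => ((b.1, Sum.inl b.2) : Idx (towerTorus Lc M k) (Fib d)))
              (fun b : ↥(pbox (towerTorus Lc M k)) × Fin (d + 1) => ((b.1, Sum.inl b.2) : Idx (towerTorus Lc M k) (Fib d))))) M lev (fun _ => ctrOff (d + 1) Lc) n)
        * towerGen Lc M (fun _ => ctrOff (d + 1) Lc) n
      + (perF (towerTorus Lc M n) (bhKStepAt d ρ L 0)).submatrix
          (fun b : ↥(pbox (towerTorus Lc M n)) × Fin (d + 1) => ((b.1, Sum.inl b.2) : Idx (towerTorus Lc M n) (Fib d)))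
          (fun b : ↥(pbox (towerTorus Lc M n)) × Fin (d + 1) => ((b.1, Sum.inl b.2) : Idx (towerTorus Lc M n) (Fib d)))
        * Matrix.of (fun (b : ↥(pbox (towerTorus Lc M n)) × Fin (d + 1)) (e : NParam Lc M (fun _ => ctrOff (d + 1) Lc) n) =>
            -(cW * hb n b * evalN Lc M (fun _ => ctrOff (d + 1) Lc) n
              (fun b' : ↥(pbox (towerTorus Lc M n)) × Fin (d + 1) => (b'.1 : Site (d + 1)) + unitVec b'.2) b e))
      = 0 :=
  tower_a1_row_towerGen_eq_zero Lc N hc _ n M lev Ma hMa cf hcf w κ hκ hκn hb (fun k _ => onTowerFamily_towerTorus Lc hLc M _ k) ρ L cW K1 hlink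

end Summit.QuantumFields.BalabanUV.Beta.FP.TowerCompanionInstance

end
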